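import Summits.ValiantsHypothesis.ValiantsHypothesis.Theorems.FifoMatchingNNDivisionHardShadowConstReadTwin

/-!
(PART 4 of 7 of the port — part 4 — §5c the explicit edge test (`twinRow_dot_flat`, `twinBlind_of_blocks`, ★★★★ `blocks_decided`) + junk-tolerant `TwinPCM` (★★★ `twin_pattern_block`, ★★★★ `twinPCM_decided`); split for the 400-line cap; texts verbatim by name, docstrings added to helpers.)
# SHADOW-CONSTANT READ / TWIN ROWS — decided classes of the located law of record C′ = `ExactPencilLaw`

Theorems-side port (staged by the author val-idea-41 g3; press as `Theorems/FifoMatchingNNDivisionHardShadowConstReadTwinEdge.lean`,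
`--kind proof --supports stmt-ValiantsHypothesis-21181 --as helper`) of the crux workfile `Cruxes/NNDivisionHard/ShadowConstRead41.lean`
REV 10 @72ea85f2ab68 (sha16 a021d0dfd0d83740, 1482 l., farm rc 0 / 0 sorries / 0 warnings; critic of record val-idea-crit-9 g2: WAVE-6
KEEP/KILL LIST 2026-08-29T00:50:44Z «41 g3 … `ShadowConstRead41` r1→r6 (★★★ `exactTilted_law_on_offDiagConst`, ★★★
`exactTilted_body_of_partialCommonMax`, `offDiagConst_decided`, ★★★★ `twinBlind_decided` / `interSpan_decided` / `blocks_decided` /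
`twinPCM_decided`)» KEPT; revs 7–10 (§5c–§5f) filed after the list's 00:30Z cut, graded in the wave-7 ledger).  Namespace
`Summit.ValiantsHypothesis.ValiantsHypothesis.Theorems.FifoMatching.ShadowConstRead` (parallel to `…LocatedRows`, whose frame — `T`, `RowFamily`, `three_pow_le_of_block`,
`hCOR`, `exactTilted`, `ExactPencilLaw`, `concl_of_lawBody`, `T_lt_of_block'`, `two_pow_half_mul_le` — is used BY NAME).

CONTENT: typed DECIDED CLASSES of the located law C′ (`exactTilted.Law`) in the tree's flat socket
`HasEFOfSize (corPolytope n + convexHull ℝ (Set.range q)) r → T c n < r`: shadow-constant / diagonal passengers (anchored star–clique tilt),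
partial-common-maximiser lists (junk-tolerant Kaibel–Weltge count), twin-blind / twin-PCM lists (antipodal twin rows; every span of 38 g2's
interaction matrices, so `Q_II`), and the twin transfer: a unique top — or a PCM on the top fibre — of ONE entrywise-nonnegative `S × S` pin.

HONEST LABEL: support theorems about the located LAW C′ on CLASSES of passengers, for an OPEN crux; `ExactPencilLaw` (C′), COR-VIRTUAL,
21181 `NNDivisionHard` are OPEN.  VP ≠ VNP is NOT proved here or anywhere in this tree.
-/

set_option autoImplicit false

-- the mandated summit-side namespace repeats a component by design (single-problem summit)
set_option linter.dupNamespace false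

noncomputable section

namespace Summit.ValiantsHypothesis.ValiantsHypothesis.Theorems.FifoMatching.ShadowConstRead

open Matrix Finset
open Literature.Barriers.PneNP (HasEFOfSize three_pow_le_card_mul_two_pow_of_cover_univ)
open Literature.Combinatorics.Optimization.FixedSizePsdRank (Cube bvec flat vecOuter corPolytope flat_dotProduct_vecOuter
  flat_dotProduct_le_of_mem_corPolytope)
open Summit.ValiantsHypothesis.ValiantsHypothesis.Theorems.FifoMatching.XcDivision
  (udInd udPt udRow udMat udInd_apply udInd_sq udInd_inter ud_data udRow_dotProduct_flat_diagonal flat_dotProduct_flat)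
open Summit.ValiantsHypothesis.ValiantsHypothesis.Theorems.FifoMatching.GridCorShadow (four_T_lt_two_pow)
open Summit.ValiantsHypothesis.ValiantsHypothesis.Theorems.FifoMatching.LocatedRows
  (T RowFamily three_pow_le_of_block two_pow_half_mul_le T_lt_of_block' hCOR le_hCOR exists_eq_hCOR flat_le_hCOR exactTilted ExactPencilLaw
    concl_of_lawBody CorVirtualHardN corVirtualHardN_of_exactPencilLaw sum_mul_udInd flat_dotProduct_udPt_eq flat_sub' flat_add')
open scoped Pointwise

section Part4
variable {k n : ℕ}

/-! §1 THE FRAME is the tree's, BY NAME: `T`, `RowFamily`, `three_pow_le_of_block`, `hCOR`, `le_hCOR`, `exists_eq_hCOR`, `flat_le_hCOR`,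
`exactTilted`, `ExactPencilLaw`, `concl_of_lawBody` (`…RowFamilies` / `…LocatedRowsColumnCoupled`), `two_pow_half_mul_le` (`…PairPencil`),
`T_lt_of_block'` (`…PinExposed`), `sum_mul_udInd` / `flat_dotProduct_udPt_eq` (`…LocatedRowsCeiling`). -/
/-! ### §5c (E20) THE EXPLICIT EDGE TEST and the junk-tolerant twin block

`twinRow a ⬝ᵥ flat M = Σ_{i,m} udMat a i m · (M (ι₁ i) (ι₁ m) − M (ι₂ i) (ι₂ m))` (`twinRow_dot_flat`): a twin row reads ONLY the difference of the
two diagonal twin blocks, through the symmetric matrix `udMat a`.  Hence (the test object crit-9 V#88 asks for — the passenger's EDGE / difference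
directions): if every difference `Qm j − Qm j'` has EQUAL SYMMETRISED DIAGONAL TWIN BLOCKS, the passenger is twin-blind (`twinBlind_of_blocks`) and
DECIDED (`blocks_decided`).  Junk-tolerantly (KW needs zeros only on the `|a∩b| = 1` cells): a PARTIAL common maximiser of the twin rows per column
(`TwinPCM`) already gives the block (`twin_pattern_block`, `twinPCM_decided`). -/

/-- symmetric × antisymmetric sums vanish. -/
theorem sum_symm_mul_antisymm (S X : Fin k → Fin k → ℝ) (hS : ∀ i m, S i m = S m i) (hX : ∀ i m, X i m + X m i = 0) :
    ∑ i, ∑ m, S i m * X i m = 0 := by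
  have h1 : ∑ i, ∑ m, S i m * X i m = ∑ i, ∑ m, S m i * X m i := Finset.sum_comm
  have h2 : ∑ i, ∑ m, S m i * X m i = ∑ i, ∑ m, -(S i m * X i m) := by
    refine Finset.sum_congr rfl fun i _ => Finset.sum_congr rfl fun m _ => ?_
    rw [hS m i, show X m i = -X i m by linarith [hX i m]]
    ring
  rw [h2] at h1
  simp only [Finset.sum_neg_distrib] at h1
  linarith

/-- `udMat (s.map ι) (ι i) (ι m) = udMat s i m`. -/
theorem udMat_map_apply (ι : Fin k ↪ Fin n) (a : Finset (Fin k)) (i m : Fin k) :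
    udMat (a.map ι) (ι i) (ι m) = udMat a i m := by
  simp only [udMat, udInd_map_self, EmbeddingLike.apply_eq_iff_eq]

/-- `udMat (s.map ι)` vanishes off the image of `ι` (row index). -/
theorem udMat_map_eq_zero_left (ι : Fin k ↪ Fin n) (a : Finset (Fin k)) {x : Fin n}
    (hx : x ∉ (Finset.univ : Finset (Fin k)).map ι) (y : Fin n) : udMat (a.map ι) x y = 0 := by
  have h0 : udInd (a.map ι) x = 0 := by
    rw [udInd_apply, if_neg]
    exact fun h => hx (Finset.map_subset_map.mpr (Finset.subset_univ a) h)
  simp only [udMat, h0, mul_zero, zero_mul, sub_zero]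

/-- `udMat (s.map ι)` vanishes off the image of `ι` (column index). -/
theorem udMat_map_eq_zero_right (ι : Fin k ↪ Fin n) (a : Finset (Fin k)) (x : Fin n) {y : Fin n}
    (hy : y ∉ (Finset.univ : Finset (Fin k)).map ι) : udMat (a.map ι) x y = 0 := by
  have h0 : udInd (a.map ι) y = 0 := by
    rw [udInd_apply, if_neg]
    exact fun h => hy (Finset.map_subset_map.mpr (Finset.subset_univ a) h)
  by_cases hxy : x = y
  · subst hxy
    simp only [udMat, h0, mul_zero, sub_zero]
  · simp only [udMat, hxy, if_false, mul_zero, zero_mul, h0, sub_zero]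

/-- reindex a sum over `Fin n` supported on the image of `ι`. -/
theorem sum_eq_sum_map (ι : Fin k ↪ Fin n) (g : Fin n → ℝ) (hg : ∀ x, x ∉ (Finset.univ : Finset (Fin k)).map ι → g x = 0) :
    ∑ x, g x = ∑ i, g (ι i) := by
  rw [← Finset.sum_subset (Finset.subset_univ ((Finset.univ : Finset (Fin k)).map ι)) (fun x _ hx => hg x hx), Finset.sum_map]

/-- `⟨udRow (s.map ι), flat M⟩` as a sum over `Fin k × Fin k` through `ι`. -/
theorem udRow_map_dot_flat (ι : Fin k ↪ Fin n) (a : Finset (Fin k)) (M : Matrix (Fin n) (Fin n) ℝ) :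
    udRow (a.map ι) ⬝ᵥ flat M = ∑ i, ∑ m, udMat a i m * M (ι i) (ι m) := by
  unfold udRow
  rw [flat_dotProduct_flat]
  rw [sum_eq_sum_map ι _ (fun x hx => Finset.sum_eq_zero fun y _ => by rw [udMat_map_eq_zero_left ι a hx, zero_mul])]
  refine Finset.sum_congr rfl fun i _ => ?_
  rw [sum_eq_sum_map ι _ (fun y hy => by rw [udMat_map_eq_zero_right ι a _ hy, zero_mul])]
  refine Finset.sum_congr rfl fun m _ => ?_
  rw [udMat_map_apply]

/-- ★ THE EDGE TEST OBJECT: a twin row reads only the DIFFERENCE OF THE TWO DIAGONAL TWIN BLOCKS (through the symmetric `udMat a`). -/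
theorem twinRow_dot_flat (ι₁ ι₂ : Fin k ↪ Fin n) (a : Finset (Fin k)) (M : Matrix (Fin n) (Fin n) ℝ) :
    twinRow ι₁ ι₂ a ⬝ᵥ flat M = ∑ i, ∑ m, udMat a i m * (M (ι₁ i) (ι₁ m) - M (ι₂ i) (ι₂ m)) := by
  unfold twinRow
  rw [sub_dotProduct, udRow_map_dot_flat, udRow_map_dot_flat, ← Finset.sum_sub_distrib]
  refine Finset.sum_congr rfl fun i _ => ?_
  rw [← Finset.sum_sub_distrib]
  refine Finset.sum_congr rfl fun m _ => ?_
  ring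

/-- `udMat a` is symmetric. -/
theorem udMat_symm (a : Finset (Fin k)) (i m : Fin k) : udMat a i m = udMat a m i := by
  by_cases h : i = m
  · subst h; rfl
  · have h' : ¬ m = i := fun e => h e.symm
    simp only [udMat, h, h', if_false]
    ring

/-- ★★ EQUAL SYMMETRISED DIAGONAL TWIN BLOCKS OF EVERY DIFFERENCE ⇒ TWIN-BLIND (the explicit, mechanically checkable edge test (E19)/(E20)). -/
theorem twinBlind_of_blocks (ι₁ ι₂ : Fin k ↪ Fin n) {K : ℕ} (Qm : Fin (K + 1) → Matrix (Fin n) (Fin n) ℝ)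
    (hblk : ∀ (j j' : Fin (K + 1)) (i m : Fin k),
      ((Qm j - Qm j') (ι₁ i) (ι₁ m) + (Qm j - Qm j') (ι₁ m) (ι₁ i))
        = ((Qm j - Qm j') (ι₂ i) (ι₂ m) + (Qm j - Qm j') (ι₂ m) (ι₂ i))) :
    TwinBlind ι₁ ι₂ (fun j => flat (Qm j)) := by
  intro a j j'
  have h0 : twinRow ι₁ ι₂ a ⬝ᵥ flat (Qm j - Qm j') = 0 := by
    rw [twinRow_dot_flat]
    exact sum_symm_mul_antisymm (fun i m => udMat a i m) _ (udMat_symm a) (fun i m => by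
      have := hblk j j' i m
      linarith)
  rw [flat_sub', dotProduct_sub] at h0
  show twinRow ι₁ ι₂ a ⬝ᵥ flat (Qm j) = twinRow ι₁ ι₂ a ⬝ᵥ flat (Qm j')
  linarith

/-- ★★★★ **EQUAL-TWIN-BLOCK PASSENGERS ARE DECIDED** (flat socket): matrices `Qm j` whose pairwise differences have equal symmetrised diagonal twin
blocks for SOME twin pair covering all but `≤ 1` point. -/
theorem blocks_decided (c₀ : ℕ) : ∃ n₀ : ℕ, ∀ n ≥ n₀, ∀ (k : ℕ) (ι₁ ι₂ : Fin k ↪ Fin n), (∀ i j, ι₁ i ≠ ι₂ j) → n ≤ 2 * k + 1 →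
    ∀ (K : ℕ) (Qm : Fin (K + 1) → Matrix (Fin n) (Fin n) ℝ) (r : ℕ),
    (∀ (j j' : Fin (K + 1)) (i m : Fin k), ((Qm j - Qm j') (ι₁ i) (ι₁ m) + (Qm j - Qm j') (ι₁ m) (ι₁ i))
        = ((Qm j - Qm j') (ι₂ i) (ι₂ m) + (Qm j - Qm j') (ι₂ m) (ι₂ i))) →
    HasEFOfSize (corPolytope n + convexHull ℝ (Set.range fun j => flat (Qm j))) r → T c₀ n < r := by
  obtain ⟨n₀, hn₀⟩ := twinBlind_decided c₀
  exact ⟨n₀, fun n hn k ι₁ ι₂ hι hnk K Qm r hblk hR => hn₀ n hn k ι₁ ι₂ hι hnk K _ r (twinBlind_of_blocks ι₁ ι₂ Qm hblk) hR⟩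

/-- «TWIN-PCM»: per column `b`, ONE listed point maximises every twin row `a` with `|a ∩ b| = 1` (junk elsewhere is ignored). -/
def TwinPCM (ι₁ ι₂ : Fin k ↪ Fin n) {K : ℕ} (q : Fin (K + 1) → (Fin (n * n) → ℝ)) : Prop :=
  ∀ b : Finset (Fin k), ∃ j : Fin (K + 1), ∀ a : Finset (Fin k), (a ∩ b).card = 1 →
    ∀ j', twinRow ι₁ ι₂ a ⬝ᵥ q j' ≤ twinRow ι₁ ι₂ a ⬝ᵥ q j

/-- twin-blind lists trivially have partial common maximisers. -/
theorem twinPCM_of_twinBlind (ι₁ ι₂ : Fin k ↪ Fin n) {K : ℕ} {q : Fin (K + 1) → (Fin (n * n) → ℝ)} (hq : TwinBlind ι₁ ι₂ q) :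
    TwinPCM ι₁ ι₂ q :=
  fun _ => ⟨0, fun a _ j' => le_of_eq (hq a j' 0)⟩

/-- ★★★ THE JUNK-TOLERANT TWIN BLOCK: a partial common maximiser per column suffices for `3^{k−2} ≤ (r+1)·2^{k−2}`. -/
theorem twin_pattern_block (ι₁ ι₂ : Fin k ↪ Fin n) (hι : ∀ i j, ι₁ i ≠ ι₂ j) {K r : ℕ} (q : Fin (K + 1) → (Fin (n * n) → ℝ))
    (hq : TwinPCM ι₁ ι₂ q) {z₁ z₂ : Fin k} (hz : z₁ ≠ z₂)
    (mrow : exactTilted.A n → ℝ) (hm1 : ∀ a j, exactTilted.ρ n a ⬝ᵥ q j ≤ mrow a)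
    (hm2 : ∀ a, ∃ j, exactTilted.ρ n a ⬝ᵥ q j = mrow a)
    (U : exactTilted.A n → Option (Fin r) → ℝ) (V : Finset (Fin n) × Fin (K + 1) → Option (Fin r) → ℝ)
    (hU : ∀ a i, 0 ≤ U a i) (hV : ∀ p i, 0 ≤ V p i)
    (hfac : ∀ a b j, (exactTilted.β n a + mrow a) - exactTilted.ρ n a ⬝ᵥ (udPt b + q j) = ∑ i, U a i * V (b, j) i) :
    3 ^ (k - 2) ≤ (r + 1) * 2 ^ (k - 2) := by
  classical
  set α : Finset (Fin k) := (Finset.univ.erase z₁).erase z₂ with hαdef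
  have hz₂ : z₂ ∈ Finset.univ.erase z₁ := Finset.mem_erase.mpr ⟨hz.symm, Finset.mem_univ _⟩
  have hαcard : α.card = k - 2 := by
    rw [hαdef, Finset.card_erase_of_mem hz₂, Finset.card_erase_of_mem (Finset.mem_univ _), Finset.card_univ, Fintype.card_fin]
    omega
  have hαmem : ∀ x ∈ α, x ≠ z₁ ∧ x ≠ z₂ := fun x hx => by
    simp only [hαdef, Finset.mem_erase] at hx
    exact ⟨hx.2.1, hx.1⟩
  have hz₁e : ∀ s : Finset ↥α, z₁ ∉ embα α s := fun s h => (hαmem _ (mem_of_mem_embα h)).1 rfl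
  have hz₂e : ∀ s : Finset ↥α, z₂ ∉ embα α s := fun s h => (hαmem _ (mem_of_mem_embα h)).2 rfl
  let full : Finset ↥α → Finset (Fin k) := fun a' => insert z₁ (insert z₂ (embα α a'))
  have hfull_card : ∀ a', (full a').card = a'.card + 2 := fun a' => by
    have h1 : z₁ ∉ insert z₂ (embα α a') := fun h => by
      rcases Finset.mem_insert.mp h with h | h
      · exact hz h
      · exact hz₁e a' h
    show (insert z₁ (insert z₂ (embα α a'))).card = _
    rw [Finset.card_insert_of_notMem h1, Finset.card_insert_of_notMem (hz₂e a'), card_embα]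
  have hfull_inter : ∀ a' b' : Finset ↥α, full a' ∩ embα α b' = embα α (a' ∩ b') := fun a' b' => by
    show insert z₁ (insert z₂ (embα α a')) ∩ embα α b' = _
    rw [Finset.insert_inter_of_notMem (hz₁e b'), Finset.insert_inter_of_notMem (hz₂e b'), embα_inter]
  let row : Finset ↥α → exactTilted.A n := fun a' => ((full a').map ι₁, -udMat ((full a').map ι₂))
  let colset : Finset ↥α → Finset (Fin n) := fun b' => (embα α b').map ι₁ ∪ (Finset.univ : Finset (Fin k)).map ι₂
  have hρ : ∀ a', exactTilted.ρ n (row a') = twinRow ι₁ ι₂ (full a') := fun a' => by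
    show udRow ((full a').map ι₁) + flat (-udMat ((full a').map ι₂)) = udRow ((full a').map ι₁) - flat (udMat ((full a').map ι₂))
    rw [flat_neg₄₁, sub_eq_add_neg]
  have hβ : ∀ a', exactTilted.β n (row a') = 1 + hCOR (-udMat ((full a').map ι₂)) := fun _ => rfl
  -- the partial common maximisers
  unfold TwinPCM at hq
  choose jc hjc using hq
  -- the COR part of the located slack on the block
  have hcor : ∀ a' b' : Finset ↥α, exactTilted.β n (row a') - exactTilted.ρ n (row a') ⬝ᵥ udPt (colset b')
      = (1 - ((a' ∩ b').card : ℝ)) ^ 2 := fun a' b' => by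
    have hi1 : (full a').map ι₁ ∩ colset b' = (embα α (a' ∩ b')).map ι₁ := by
      show (full a').map ι₁ ∩ ((embα α b').map ι₁ ∪ (Finset.univ : Finset (Fin k)).map ι₂) = _
      rw [map_inter_col ι₁ ι₂ hι, hfull_inter]
    have hi2 : (full a').map ι₂ ∩ colset b' = (full a').map ι₂ := map_inter_col' ι₁ ι₂ hι _ _
    rw [hβ, hCOR_negUd ι₂ _ (by rw [hfull_card]; omega), hρ, twinRow_dot_udPt, hi1, hi2, Finset.card_map, Finset.card_map, card_embα,
      hfull_card]
    push_cast
    ring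
  have key := three_pow_le_of_pattern U V hU hV row (fun b' => (colset b', jc (embα α b'))) (fun a' b' hab => ?_) (fun a' b' hab => ?_)
  · have h1 : Fintype.card ↥α = k - 2 := by rw [Fintype.card_coe, hαcard]
    have h2 : Fintype.card (Option (Fin r)) = r + 1 := by simp
    rw [h1, h2] at key
    exact key
  · -- zero cells: `|a' ∩ b'| = 1` ⇒ COR part 0 and the column's index maximises the row
    have hfull1 : (full a' ∩ embα α b').card = 1 := by rw [hfull_inter, card_embα, hab]
    have hmax : exactTilted.ρ n (row a') ⬝ᵥ q (jc (embα α b')) = mrow (row a') := by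
      apply le_antisymm (hm1 _ _)
      obtain ⟨j', hj'⟩ := hm2 (row a')
      rw [← hj', hρ]
      exact hjc (embα α b') (full a') hfull1 j'
    rw [← hfac (row a') (colset b') (jc (embα α b')), dotProduct_add, hmax]
    have := hcor a' b'
    rw [hab] at this
    push_cast at this
    linarith
  · -- positive cells: disjoint ⇒ COR part 1, passenger part ≥ 0
    have hab0 : (a' ∩ b').card = 0 := by rw [Finset.disjoint_iff_inter_eq_empty.mp hab, Finset.card_empty]
    rw [← hfac (row a') (colset b') (jc (embα α b')), dotProduct_add]
    have := hcor a' b'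
    rw [hab0] at this
    push_cast at this
    have hle := hm1 (row a') (jc (embα α b'))
    linarith

/-- ★★★★ **TWIN-PCM PASSENGERS ARE DECIDED** (flat socket; junk-tolerant version of `twinBlind_decided`). -/
theorem twinPCM_decided (c₀ : ℕ) : ∃ n₀ : ℕ, ∀ n ≥ n₀, ∀ (k : ℕ) (ι₁ ι₂ : Fin k ↪ Fin n), (∀ i j, ι₁ i ≠ ι₂ j) → n ≤ 2 * k + 1 →
    ∀ (K : ℕ) (q : Fin (K + 1) → (Fin (n * n) → ℝ)) (r : ℕ), TwinPCM ι₁ ι₂ q →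
    HasEFOfSize (corPolytope n + convexHull ℝ (Set.range q)) r → T c₀ n < r := by
  classical
  obtain ⟨n₀, hn₀⟩ := T_lt_of_block_wide c₀
  refine ⟨max n₀ 5, fun n hn k ι₁ ι₂ hι hnk K q r hq hR => ?_⟩
  have hn5 : 5 ≤ n := le_of_max_le_right hn
  have hk2 : 2 ≤ k := by omega
  refine concl_of_lawBody exactTilted q (fun m hm1 hm2 U V hU hV hfac => ?_) hR
  have hz : (⟨0, by omega⟩ : Fin k) ≠ ⟨1, by omega⟩ := Fin.ne_of_val_ne (by norm_num)
  have hblock := twin_pattern_block ι₁ ι₂ hι q hq hz m hm1 hm2 U V hU hV hfac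
  exact hn₀ n (le_of_max_le_left hn) (k - 2) r (by omega) hblock

end Part4

end Summit.ValiantsHypothesis.ValiantsHypothesis.Theorems.FifoMatching.ShadowConstRead
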